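import Summits.NavierStokesRegularity.NavierStokesRegularity.Theorems.LocalSineTubeDoorLocalPointZoomZoom
import Summits.NavierStokesRegularity.NavierStokesRegularity.Theorems.AdaptedFrequencyFrequencyRigidityTypeIBoundTimeDilation
import Literature.Analysis.FluidPDE.LocalTypeIReverseTools
import Literature.Analysis.FluidPDE.ClassicalSuitable
import HarnessLib

/-!
# Crux `TerminalTrace.TypeITraceScarL3` (stmt-NavierStokesRegularity-18385), line `extinct-apex`:
# STUB 1 `stub_localTypeI_of_typeIBlowup` — a Type-I-in-time blow-up is locally Type I (in the
# sense of Albritton–Barker) at every apex point, IN THE FRAME OF THE ITEM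

Prover seat nsreg-p4 (gen 14) for the planner nsreg-p2 (gen 26, ROUND-24 «the scar at the last
slice», skeleton `HOME/ns-regularity-ideate-p2/R24-line-extinct-apex.lean`, sha16 07e82d2c7e70161a;
`--supports stmt-NavierStokesRegularity-18385`).  Theorems only; the stub is proved BY NAME and
SIGNATURE (`stub_localTypeI_of_typeIBlowup`, verbatim the skeleton's l.50 statement; own namespace as for the
K2 precedent `Theorems/PoloidalWindowDoorPoloidalWindowRigidityStubUntwisted.lean`).

Print: D. Albritton, T. Barker, arXiv:1811.00502, Lemma 2.5 (case `p = ∞`, `q = 2`), which in the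
tree is the THEOREM `Literature.Analysis.FluidPDE.albrittonBarker2019_lemma_2_5_rate_holds`; its use at a
locally Type-I final-time point of a classical solution, after the viscosity-normalising zoom, is the
tree theorem `LocalSineTubeDoorLocalPointZoomZoom.exists_zoom_typeIBound_lt_top_of_localTypeI`
(`𝐈(Q(0,1/2)) < ⊤` for `v = α u(T + βs, x₀ + Ry)`, `β = R²/ν`, `α = R/ν`).  The stub asks for
`𝐈 < ⊤` on a parabolic ball of the ORIGINAL pair `(u, p)` (viscosity `ν`, ν-free parabolic balls,
un-gauged pressure).  The un-zoom:

* EXACT parabolic part: `v` is the `R`-zoom about `(νT, x₀)` of the viscosity time-stretch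
  `w(τ, x) = ν⁻¹ u(τ/ν, x)` (unit viscosity), so `𝐈_w(Q((νT, x₀), R/2)) = 𝐈_v(Q(0, 1/2))` by the
  tree's `typeIBound_nsZoom`;
* TIME DILATION `u(t, x) = ν w(νt, x)` (not a parabolic map): the tree's COVERING bounds
  `timeDil_cknAEss_le`, `timeDil_cknC_le`, `timeDil_cknDOsc_le`, `timeDil_cknE_le`
  (`Theorems/AdaptedFrequencyFrequencyRigidityTypeIBoundTimeDilation.lean`, line `scaled-energy-split`
  of crux 2955) control each admissible ball of the dilated triple by `N ≥ 2ν` parabolic balls of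
  `w` with the same spatial ball; here in a LOCAL version (`typeIBound_timeDilation_local`): the
  covering balls of every `Q(z, r) ⊆ Q((T, x₀), r₀)` lie in `Q((νT, x₀), ρ)` as soon as
  `r₀ ≤ ρ` and `(ν + N/2 + 1) r₀² ≤ ρ²`;
* GAUGE: `D` does not see the time-dependent constant `p(t,0) − normalisedPressure(u(t)) 0`
  (`cknDOsc_sub_fun_time`; the classical pressure slices are continuous, hence integrable on balls);
* the classical gradient is a weak spatial gradient (`hasWeakSpatialGradientOn_of_contDiffOn`).

WHAT THIS IS NOT: not a regularity or blow-up claim — Albritton–Barker's local Type-I bookkeeping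
for a hypothetical Type-I-in-time singularity; the crux `TypeITraceScarL3` and its open stub
`stub_no_extinctApex` are untouched.
-/

noncomputable section

open MeasureTheory Set Function Filter Topology Metric
open scoped NNReal ENNReal InnerProductSpace RealInnerProductSpace
open Literature.Analysis.FluidPDE
open Summit.NavierStokesRegularity.NavierStokesRegularity.Theorems.FrequencyRigidity.ScaledEnergySplit

namespace Summit.NavierStokesRegularity.NavierStokesRegularity.Theorems.TerminalTraceTypeITraceScarL3StubLocalTypeIOfTypeIBlowup

local notation "ℝ³" => EuclideanSpace ℝ (Fin 3)

/-! ## The local time-dilation lemma -/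

/-- Admissible balls of `Q((T, x₀), r₀)`: `Q(z, r) ⊆ Q((T, x₀), r₀)` with `r > 0` forces
`T − r₀² ≤ z.1 − r²`, `z.1 ≤ T` and `B(z.2, r) ⊆ B(x₀, r₀)`. -/
theorem parabolicCylinder_subset_iff_of_pos {r r₀ T : ℝ} {x₀ : EuclideanSpace ℝ (Fin 3)}
    {z : ℝ × EuclideanSpace ℝ (Fin 3)} (hr : 0 < r)
    (h : parabolicCylinder r z ⊆ parabolicCylinder r₀ ((T, x₀) : ℝ × EuclideanSpace ℝ (Fin 3))) :
    (T - r₀ ^ 2 ≤ z.1 - r ^ 2 ∧ z.1 ≤ T) ∧ ball z.2 r ⊆ ball x₀ r₀ := by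
  rw [parabolicCylinder, parabolicCylinder, prod_subset_prod_iff] at h
  rcases h with ⟨h1, h2⟩ | h | h
  · exact ⟨(Ioo_subset_Ioo_iff (by nlinarith)).1 h1, h2⟩
  · exact absurd h (nonempty_Ioo.2 (by nlinarith)).ne_empty
  · exact absurd h (nonempty_ball.2 hr).ne_empty

/-- The covering balls of an admissible ball stay inside the big ball of the undilated frame: if
`Q(z, r) ⊆ Q((T, x₀), r₀)`, `r₀ ≤ ρ`, `(β + N/2 + 1) r₀² ≤ ρ²` and `k < N`, then
`Q((βz.1 − k r²/2, z.2), r) ⊆ Q((βT, x₀), ρ)`. -/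
theorem timeDil_cover_subset {β r r₀ ρ T : ℝ} {x₀ : EuclideanSpace ℝ (Fin 3)}
    {z : ℝ × EuclideanSpace ℝ (Fin 3)} {N : ℕ} (hβ : 0 < β) (hr : 0 < r) (hr₀ρ : r₀ ≤ ρ)
    (hfit : (β + N / 2 + 1) * r₀ ^ 2 ≤ ρ ^ 2)
    (hz : parabolicCylinder r z ⊆ parabolicCylinder r₀ ((T, x₀) : ℝ × EuclideanSpace ℝ (Fin 3)))
    (k : Fin N) :
    parabolicCylinder r ((β * z.1 - ((k : ℕ) : ℝ) * (r ^ 2 / 2), z.2) : ℝ × EuclideanSpace ℝ (Fin 3)) ⊆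
      parabolicCylinder ρ ((β * T, x₀) : ℝ × EuclideanSpace ℝ (Fin 3)) := by
  obtain ⟨⟨h1, h2⟩, hB⟩ := parabolicCylinder_subset_iff_of_pos hr hz
  have hk : ((k : ℕ) : ℝ) ≤ N := by exact_mod_cast k.2.le
  have hrr : r ^ 2 ≤ r₀ ^ 2 := by nlinarith
  have hk' : ((k : ℕ) : ℝ) * (r ^ 2 / 2) ≤ N * (r₀ ^ 2 / 2) :=
    mul_le_mul hk (by linarith) (by positivity) (by positivity)
  refine prod_mono (Ioo_subset_Ioo ?_ ?_) (hB.trans (ball_subset_ball hr₀ρ))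
  · have : β * (T - r₀ ^ 2) ≤ β * (z.1 - r ^ 2) := mul_le_mul_of_nonneg_left h1 hβ.le
    nlinarith
  · have : β * z.1 ≤ β * T := mul_le_mul_of_nonneg_left h2 hβ.le
    have : 0 ≤ ((k : ℕ) : ℝ) * (r ^ 2 / 2) := by positivity
    show β * z.1 - ((k : ℕ) : ℝ) * (r ^ 2 / 2) ≤ β * T
    linarith

/-- **`𝐈` stays finite under time dilation, local version.**  For `β > 0`, reals `a`, `b`, a natural
`N ≥ 2β` and radii `0 < r₀ ≤ ρ` with `(β + N/2 + 1) r₀² ≤ ρ²`: if `𝐈(Q((βT, x₀), ρ); w, π, G) < ∞` then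
the time-dilated triple `(a w(βt, x), b π(βt, x), a G(βt, x))` has `𝐈(Q((T, x₀), r₀)) < ∞` (the
covering argument of `stub_typeIBound_timeDilation`, every covering ball being admissible by
`timeDil_cover_subset`). -/
theorem typeIBound_timeDilation_local {β : ℝ} (hβ : 0 < β) (a b : ℝ)
    (w : ℝ → EuclideanSpace ℝ (Fin 3) → EuclideanSpace ℝ (Fin 3)) (π : ℝ → EuclideanSpace ℝ (Fin 3) → ℝ)
    (G : ℝ → EuclideanSpace ℝ (Fin 3) → EuclideanSpace ℝ (Fin 3) →L[ℝ] EuclideanSpace ℝ (Fin 3))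
    {T : ℝ} {x₀ : EuclideanSpace ℝ (Fin 3)} {ρ r₀ : ℝ} {N : ℕ} (hN : 2 * β ≤ N) (hr₀ρ : r₀ ≤ ρ)
    (hfit : (β + N / 2 + 1) * r₀ ^ 2 ≤ ρ ^ 2)
    (hI : typeIBound (parabolicCylinder ρ ((β * T, x₀) : ℝ × EuclideanSpace ℝ (Fin 3))) w π G < ⊤) :
    typeIBound (parabolicCylinder r₀ ((T, x₀) : ℝ × EuclideanSpace ℝ (Fin 3)))
      (fun t x => a • w (β * t) x) (fun t x => b * π (β * t) x) (fun t x => a • G (β * t) x) < ⊤ := by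
  set I₀ := typeIBound (parabolicCylinder ρ ((β * T, x₀) : ℝ × EuclideanSpace ℝ (Fin 3))) w π G
    with hI₀
  have hβ' : ENNReal.ofReal β⁻¹ < ⊤ := ENNReal.ofReal_lt_top
  have ha2 : ‖a‖ₑ ^ 2 < ⊤ := ENNReal.pow_lt_top enorm_lt_top
  have ha3 : ‖a‖ₑ ^ 3 < ⊤ := ENNReal.pow_lt_top enorm_lt_top
  have hb : ‖b‖ₑ ^ (3 / 2 : ℝ) < ⊤ := ENNReal.rpow_lt_top_of_nonneg (by norm_num) enorm_ne_top
  have hK : (‖a‖ₑ ^ 2 + ‖a‖ₑ ^ 3 * ENNReal.ofReal β⁻¹ + ‖b‖ₑ ^ (3 / 2 : ℝ) * ENNReal.ofReal β⁻¹ +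
      ENNReal.ofReal (a ^ 2) * ENNReal.ofReal β⁻¹) * ((N : ℝ≥0∞) * I₀) < ⊤ :=
    ENNReal.mul_lt_top
      (ENNReal.add_lt_top.2 ⟨ENNReal.add_lt_top.2 ⟨ENNReal.add_lt_top.2
        ⟨ha2, ENNReal.mul_lt_top ha3 hβ'⟩, ENNReal.mul_lt_top hb hβ'⟩,
        ENNReal.mul_lt_top ENNReal.ofReal_lt_top hβ'⟩)
      (ENNReal.mul_lt_top (ENNReal.natCast_lt_top N) hI)
  refine lt_of_le_of_lt (typeIBound_le_iff.2 fun r hr z hz => ?_) hK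
  have hIk : ∀ k : Fin N,
      abScaledSum r ((β * z.1 - ((k : ℕ) : ℝ) * (r ^ 2 / 2), z.2) : ℝ × EuclideanSpace ℝ (Fin 3))
        w π G ≤ I₀ := fun k =>
    abScaledSum_le_typeIBound hr (timeDil_cover_subset hβ hr hr₀ρ hfit hz k)
  have hXle : ∀ w' : ℝ × EuclideanSpace ℝ (Fin 3),
      cknAEss r w' w ≤ abScaledSum r w' w π G ∧ cknC r w' w ≤ abScaledSum r w' w π G ∧
        cknDOsc r w' π ≤ abScaledSum r w' w π G ∧ cknE r w' G ≤ abScaledSum r w' w π G := fun w' =>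
    ⟨le_add_right (le_add_right le_self_add), le_add_right (le_add_right le_add_self),
      le_add_right le_add_self, le_add_self⟩
  have hsumI : ∑ _k : Fin N, I₀ = N * I₀ := by
    rw [Finset.sum_const, Finset.card_univ, Fintype.card_fin, nsmul_eq_mul]
  have hA : ∑ k : Fin N,
      cknAEss r ((β * z.1 - ((k : ℕ) : ℝ) * (r ^ 2 / 2), z.2) : ℝ × EuclideanSpace ℝ (Fin 3)) w ≤
        N * I₀ :=
    (Finset.sum_le_sum fun k _ => ((hXle _).1.trans (hIk k))).trans_eq hsumI
  have hC : ∑ k : Fin N,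
      cknC r ((β * z.1 - ((k : ℕ) : ℝ) * (r ^ 2 / 2), z.2) : ℝ × EuclideanSpace ℝ (Fin 3)) w ≤
        N * I₀ :=
    (Finset.sum_le_sum fun k _ => ((hXle _).2.1.trans (hIk k))).trans_eq hsumI
  have hD : ∑ k : Fin N,
      cknDOsc r ((β * z.1 - ((k : ℕ) : ℝ) * (r ^ 2 / 2), z.2) : ℝ × EuclideanSpace ℝ (Fin 3)) π ≤
        N * I₀ :=
    (Finset.sum_le_sum fun k _ => ((hXle _).2.2.1.trans (hIk k))).trans_eq hsumI
  have hE : ∑ k : Fin N,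
      cknE r ((β * z.1 - ((k : ℕ) : ℝ) * (r ^ 2 / 2), z.2) : ℝ × EuclideanSpace ℝ (Fin 3)) G ≤
        N * I₀ :=
    (Finset.sum_le_sum fun k _ => ((hXle _).2.2.2.trans (hIk k))).trans_eq hsumI
  calc abScaledSum r z (fun t x => a • w (β * t) x) (fun t x => b * π (β * t) x)
        (fun t x => a • G (β * t) x)
      = cknAEss r z (fun t x => a • w (β * t) x) + cknC r z (fun t x => a • w (β * t) x) +
          cknDOsc r z (fun t x => b * π (β * t) x) + cknE r z (fun t x => a • G (β * t) x) := rfl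
    _ ≤ ‖a‖ₑ ^ 2 * (N * I₀) + ‖a‖ₑ ^ 3 * ENNReal.ofReal β⁻¹ * (N * I₀) +
          ‖b‖ₑ ^ (3 / 2 : ℝ) * ENNReal.ofReal β⁻¹ * (N * I₀) +
          ENNReal.ofReal (a ^ 2) * ENNReal.ofReal β⁻¹ * (N * I₀) :=
        add_le_add (add_le_add (add_le_add
          ((timeDil_cknAEss_le hβ hr hN a z w).trans (mul_le_mul_right hA _))
          ((timeDil_cknC_le hβ hr hN a z w).trans (mul_le_mul_right hC _)))
          ((timeDil_cknDOsc_le hβ hr hN b z π).trans (mul_le_mul_right hD _)))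
          ((timeDil_cknE_le hβ hr hN a z G).trans (mul_le_mul_right hE _))
    _ = _ := by ring

/-! ## The pressure gauge and the weak gradient of a classical solution -/

/-- **`𝐈` with the gauged pressure dominates `𝐈` with the original pressure** on a parabolic ball
below the final time: `D` does not see the time-dependent constant, the classical pressure slices
being continuous (integrable on balls). -/
theorem typeIBound_le_gauged {ν T : ℝ} {u : ℝ → EuclideanSpace ℝ (Fin 3) → EuclideanSpace ℝ (Fin 3)}
    {p : ℝ → EuclideanSpace ℝ (Fin 3) → ℝ} (hsol : IsClassicalNSSolutionOn (Ico 0 T) ν 0 u p)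
    (c : ℝ → ℝ) (G : ℝ → EuclideanSpace ℝ (Fin 3) → EuclideanSpace ℝ (Fin 3) →L[ℝ] EuclideanSpace ℝ (Fin 3))
    {x₀ : EuclideanSpace ℝ (Fin 3)} {r₁ : ℝ} (hr₁T : r₁ ^ 2 ≤ T) :
    typeIBound (parabolicCylinder r₁ ((T, x₀) : ℝ × EuclideanSpace ℝ (Fin 3))) u p G ≤
      typeIBound (parabolicCylinder r₁ ((T, x₀) : ℝ × EuclideanSpace ℝ (Fin 3))) u
        (fun t x => p t x - c t) G := by
  refine typeIBound_le_iff.2 fun r hr z hz => ?_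
  obtain ⟨⟨h1, h2⟩, -⟩ := parabolicCylinder_subset_iff_of_pos hr hz
  have hq : ∀ᵐ t ∂(volume.restrict (Ioo (z.1 - r ^ 2) z.1)),
      IntegrableOn (p t) (ball z.2 r) volume := by
    refine (ae_restrict_iff' measurableSet_Ioo).2 (ae_of_all _ fun t ht => ?_)
    have htI : t ∈ Ico 0 T := ⟨by linarith [ht.1], by linarith [ht.2]⟩
    exact (((hsol.contDiff_pressure htI).continuous.continuousOn).integrableOn_compact
      (isCompact_closedBall z.2 r)).mono_set ball_subset_closedBall
  have hD : cknDOsc r z (fun t x => p t x - c t) = cknDOsc r z p := cknDOsc_sub_fun_time hr c hq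
  have hsum : abScaledSum r z u p G = abScaledSum r z u (fun t x => p t x - c t) G := by
    simp only [abScaledSum, hD]
  rw [hsum]
  exact abScaledSum_le_typeIBound hr hz

/-! ## STUB 1 -/

/-- **STUB 1 of the line `extinct-apex` (Albritton–Barker 2019, Lemma 2.5 with `p = ∞`, `q = 2`),
PROVED.**  In the frame of the item (classical on `[0,T)`, Leray–Hopf on `[0,T]` from its datum,
viscosity `ν > 0`), the Type-I rate in time `‖u(t)‖_∞ ≤ C (T−t)^{-1/2}` near `T` puts every apex
point `(T, x₀)` in Albritton–Barker's local Type-I class: for some `r₀ > 0` the velocity has a weak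
spatial gradient on `Q((T,x₀), r₀)` (the classical one) and `𝐈(Q((T,x₀), r₀)) < ∞`.  Proof: the
tree's viscosity-normalising zoom theorem `exists_zoom_typeIBound_lt_top_of_localTypeI` (A–B Lemma 2.5
in the zoomed frame), un-zoomed by the exact parabolic scaling `typeIBound_nsZoom` and the local
time-dilation covering `typeIBound_timeDilation_local`; pressure gauge by `typeIBound_le_gauged`. -/
theorem stub_localTypeI_of_typeIBlowup :
    ∀ (ν T : ℝ), 0 < ν → 0 < T → ∀ (u : ℝ → ℝ³ → ℝ³) (p : ℝ → ℝ³ → ℝ),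
      IsClassicalNSSolutionOn (Ico 0 T) ν 0 u p → IsLerayHopfOn T ν 0 (u 0) u →
      IsTypeIBlowup u T → ∀ x₀ : ℝ³,
        ∃ r₀ : ℝ, 0 < r₀ ∧ ∃ G : ℝ → ℝ³ → ℝ³ →L[ℝ] ℝ³,
          HasWeakSpatialGradientOn (parabolicCylinderOpens r₀ (T, x₀)) u G ∧
          typeIBound (parabolicCylinder r₀ (T, x₀)) u p G < ∞ := by
  intro ν T hν hT u p hsol hLH hTI x₀
  -- (1) the local rate from the Type-I-in-time hypothesis
  obtain ⟨C, hC⟩ := hTI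
  obtain ⟨l, hlT, hl⟩ := (mem_nhdsLT_iff_exists_Ioo_subset' (show T - 1 < T by linarith)).1 hC
  have hlT' : l < T := hlT
  set ρ : ℝ := Real.sqrt (T - l) with hρdef
  have hρ : 0 < ρ := Real.sqrt_pos.2 (by linarith)
  have hρ2 : ρ ^ 2 = T - l := Real.sq_sqrt (by linarith)
  have hM : ∀ t ∈ Ico 0 T, T - ρ ^ 2 < t → ∀ x ∈ ball x₀ ρ,
      ‖u t x‖ * Real.sqrt (ν * (T - t)) ≤ C * Real.sqrt ν := by
    intro t ht hlt x _
    have hrate : ‖u t x‖ ≤ C / Real.sqrt (T - t) := hl ⟨by linarith, ht.2⟩ x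
    have hst : 0 < Real.sqrt (T - t) := Real.sqrt_pos.2 (by linarith [ht.2])
    calc ‖u t x‖ * Real.sqrt (ν * (T - t))
        ≤ C / Real.sqrt (T - t) * Real.sqrt (ν * (T - t)) :=
          mul_le_mul_of_nonneg_right hrate (Real.sqrt_nonneg _)
      _ = C * Real.sqrt ν := by
          rw [Real.sqrt_mul hν.le]; field_simp
  -- (2) the zoom
  obtain ⟨R, α, β, hR, hα, hβ, hβeq, hαeq, hβT, -, -, -, -, -, hI⟩ :=
    Summit.NavierStokesRegularity.NavierStokesRegularity.Theorems.LocalSineTubeDoorLocalPointZoomZoom.exists_zoom_typeIBound_lt_top_of_localTypeI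
      hν hT hsol hLH hρ hM
  set q : ℝ → EuclideanSpace ℝ (Fin 3) → ℝ := fun t x => p t x - (p t 0 - normalisedPressure (u t) 0)
    with hq
  set Gu : ℝ → EuclideanSpace ℝ (Fin 3) → EuclideanSpace ℝ (Fin 3) →L[ℝ] EuclideanSpace ℝ (Fin 3) :=
    fun t x => fderiv ℝ (u t) x with hGu
  -- (3) the viscosity time-stretch `w` and the exact parabolic un-zoom
  set w : ℝ → EuclideanSpace ℝ (Fin 3) → EuclideanSpace ℝ (Fin 3) := fun τ x => ν⁻¹ • u (ν⁻¹ * τ) x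
    with hw
  set πw : ℝ → EuclideanSpace ℝ (Fin 3) → ℝ := fun τ x => ν⁻¹ ^ 2 * q (ν⁻¹ * τ) x with hπw
  set Gw : ℝ → EuclideanSpace ℝ (Fin 3) → EuclideanSpace ℝ (Fin 3) →L[ℝ] EuclideanSpace ℝ (Fin 3) :=
    fun τ x => ν⁻¹ • Gu (ν⁻¹ * τ) x with hGw
  have htime : ∀ s : ℝ, ν⁻¹ * (ν * T + R ^ 2 * s) = T + β * s := fun s => by
    rw [hβeq]; field_simp
  have hαinv : R * ν⁻¹ = α := by simp only [hαeq, div_eq_mul_inv]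
  have hα2 : R ^ 2 * ν⁻¹ ^ 2 = α ^ 2 := by rw [← hαinv]; ring
  have hαR : R ^ 2 * ν⁻¹ = α * R := by rw [← hαinv]; ring
  have hv : α • stPull β R T x₀ u = R • stPull (R ^ 2) R (ν * T) x₀ w := by
    funext s y
    simp only [Pi.smul_apply, stPull_apply, hw, smul_smul, htime, hαinv]
  have hπ : α ^ 2 • stPull β R T x₀ q = R ^ 2 • stPull (R ^ 2) R (ν * T) x₀ πw := by
    funext s y
    simp only [Pi.smul_apply, stPull_apply, hπw, smul_eq_mul, htime, ← mul_assoc, hα2]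
  have hG : (α * R) • stPull β R T x₀ Gu = R ^ 2 • stPull (R ^ 2) R (ν * T) x₀ Gw := by
    funext s y
    simp only [Pi.smul_apply, stPull_apply, hGw, smul_smul, htime, hαR]
  have hpre : stAffine (R ^ 2) R (ν * T) x₀ ⁻¹'
      parabolicCylinder (R / 2) ((ν * T, x₀) : ℝ × EuclideanSpace ℝ (Fin 3)) =
      parabolicCylinder (1 / 2) (0 : ℝ × EuclideanSpace ℝ (Fin 3)) := by
    have h := LocalTypeIScaling.stAffine_preimage_parabolicCylinder hR (ν * T) x₀ (1 / 2) 0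
    have h0 : stAffine (R ^ 2) R (ν * T) x₀ (0 : ℝ × EuclideanSpace ℝ (Fin 3)) = (ν * T, x₀) := by
      simp [stAffine]
    rwa [h0, show R * (1 / 2) = R / 2 by ring] at h
  have hIw : typeIBound (parabolicCylinder (R / 2) ((ν * T, x₀) : ℝ × EuclideanSpace ℝ (Fin 3)))
      w πw Gw < ⊤ := by
    rw [← typeIBound_nsZoom hR (ν * T) x₀ _ w πw Gw, hpre, ← hv, ← hπ, ← hG]
    exact hI
  -- (4) the time dilation `u(t, x) = ν w(νt, x)`
  obtain ⟨N, hN⟩ := exists_nat_ge (2 * ν)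
  set r₀ : ℝ := (R / 2) / (ν + N / 2 + 1) with hr₀def
  have hden : 1 ≤ ν + N / 2 + 1 := by
    have : (0 : ℝ) ≤ N := Nat.cast_nonneg N
    linarith
  have hr₀ : 0 < r₀ := by positivity
  have hr₀ρ : r₀ ≤ R / 2 := div_le_self (by positivity) hden
  have hfit : (ν + N / 2 + 1) * r₀ ^ 2 ≤ (R / 2) ^ 2 := by
    have e : (ν + N / 2 + 1) * r₀ ^ 2 = (R / 2) ^ 2 / (ν + N / 2 + 1) := by
      rw [hr₀def]; field_simp
    rw [e]
    exact div_le_self (by positivity) hden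
  have hIw' : typeIBound (parabolicCylinder (R / 2) ((ν * (ν⁻¹ * (ν * T)), x₀) :
      ℝ × EuclideanSpace ℝ (Fin 3))) w πw Gw < ⊤ := by
    rwa [inv_mul_cancel_left₀ hν.ne']
  have hdil := typeIBound_timeDilation_local hν ν (ν ^ 2) w πw Gw (T := ν⁻¹ * (ν * T)) hN hr₀ρ hfit hIw'
  have hTT : ν⁻¹ * (ν * T) = T := inv_mul_cancel_left₀ hν.ne' T
  rw [hTT] at hdil
  have e1 : (fun t x => ν • w (ν * t) x) = u := by
    funext t x
    simp only [hw, smul_smul, mul_inv_cancel₀ hν.ne', one_smul, inv_mul_cancel_left₀ hν.ne']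
  have e2 : (fun t x => ν ^ 2 * πw (ν * t) x) = q := by
    funext t x
    simp only [hπw, inv_mul_cancel_left₀ hν.ne', ← mul_assoc]
    rw [show ν ^ 2 * ν⁻¹ ^ 2 = 1 by field_simp, one_mul]
  have e3 : (fun t x => ν • Gw (ν * t) x) = Gu := by
    funext t x
    simp only [hGw, smul_smul, mul_inv_cancel₀ hν.ne', one_smul, inv_mul_cancel_left₀ hν.ne']
  rw [e1, e2, e3] at hdil
  -- (5) shrink below `√T`, gauge, weak gradient
  set r₁ : ℝ := min r₀ (Real.sqrt T / 2) with hr₁def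
  have hr₁ : 0 < r₁ := lt_min hr₀ (by positivity)
  have hr₁T : r₁ ^ 2 ≤ T := by
    have h1 : r₁ ≤ Real.sqrt T / 2 := min_le_right _ _
    have h2 : (Real.sqrt T / 2) ^ 2 ≤ T := by
      rw [div_pow, Real.sq_sqrt hT.le]; linarith
    exact (pow_le_pow_left₀ hr₁.le h1 2).trans h2
  have hsub : parabolicCylinder r₁ ((T, x₀) : ℝ × EuclideanSpace ℝ (Fin 3)) ⊆
      parabolicCylinder r₀ ((T, x₀) : ℝ × EuclideanSpace ℝ (Fin 3)) :=
    prod_mono (Ioo_subset_Ioo (by nlinarith [min_le_left r₀ (Real.sqrt T / 2)]) le_rfl)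
      (ball_subset_ball (min_le_left _ _))
  have hslab : (parabolicCylinderOpens r₁ ((T, x₀) : ℝ × EuclideanSpace ℝ (Fin 3)) :
      Set (ℝ × EuclideanSpace ℝ (Fin 3))) ⊆ Ioo 0 T ×ˢ univ := by
    intro w' hw'
    have h := (mem_parabolicCylinder.1 hw').1
    exact ⟨⟨by linarith [h.1], h.2⟩, mem_univ _⟩
  have hWG : HasWeakSpatialGradientOn (parabolicCylinderOpens r₁ ((T, x₀) : ℝ × EuclideanSpace ℝ (Fin 3)))
      u Gu :=
    hasWeakSpatialGradientOn_of_contDiffOn isOpen_Ioo hslab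
      ((hsol.smooth_velocity.mono Ioo_subset_Ico_self).of_le (by norm_cast))
  refine ⟨r₁, hr₁, Gu, hWG, ?_⟩
  calc typeIBound (parabolicCylinder r₁ ((T, x₀) : ℝ × EuclideanSpace ℝ (Fin 3))) u p Gu
      ≤ typeIBound (parabolicCylinder r₁ ((T, x₀) : ℝ × EuclideanSpace ℝ (Fin 3))) u q Gu :=
        typeIBound_le_gauged hsol (fun t => p t 0 - normalisedPressure (u t) 0) Gu hr₁T
    _ ≤ typeIBound (parabolicCylinder r₀ ((T, x₀) : ℝ × EuclideanSpace ℝ (Fin 3))) u q Gu :=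
        typeIBound_mono hsub
    _ < ⊤ := hdil

end Summit.NavierStokesRegularity.NavierStokesRegularity.Theorems.TerminalTraceTypeITraceScarL3StubLocalTypeIOfTypeIBlowup

end
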